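import Summits.BirchSwinnertonDyer.BirchSwinnertonDyer.Theorems.Rank1ResidualJetTransverseClass
import HarnessLib

/-!
# Crux V2♭θ / V2♭∞ (stmt-BirchSwinnertonDyer-27220; line `kolyvagin_depth_split`), stub S1, piece P4 —
# Kolyvagin's class is TRANSVERSE at the primes of its conductor at `p = 2` (margin one), UNCONDITIONALLY (I)

The S1 composition `primeSwapAtTwoLossy_core[_frob]` carries the binder `hP4`: for a Kolyvagin conductor `c`
all of whose primes have index `≥ M + 1`, `loc_w c_M(c) ∈ 𝒯_w` at every `w ∣ c`. The tree proves this at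
ODD `p` (`JET.kolyvaginClass_mem_transverseKer`, Howard 2004 Lemma 2.7.3: at a place `w' ∣ λ` of `K[ℓ]`,
McCallum's cocycle restricted to `Γ_{K[ℓ]_{w'}}` is a continuous homomorphism killed by inertia and by a
Frobenius, because the reduction of `P(c) = D_ℓ(…)` is `ℓ(ℓ+1)/2` times a `φ²`-fixed point), and its ONLY use
of `p ≠ 2` is the divisibility `p^k ∣ ℓ(ℓ+1)/2` (`JET.pow_dvd_choose_two`). This file re-runs the three
bricks with that divisibility as the hypothesis (`…_of_dvd`: any prime), and specialises to `p = 2`, where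
`2^k ∣ ℓ(ℓ+1)/2` follows from the MARGIN-ONE index condition `2^{k+1} ∣ ℓ + 1` (`k + 1 ≤ M(ℓ)`):

* THIS FILE (I): `two_pow_dvd_choose_two`, `exists_map_derivOp_eq_pow_smul_of_dvd` (algebra) and
  `exists_red_derivedPoint_eq_pow_smul_of_dvd` (BRICK B3 at any prime `p`);
* SEQUEL (II, `…TransverseClassAtTwo`): `kolyvaginClass_mem_transverseKer_of_dvd` (Howard 2.7.3, any `p`),
  `kolyvaginClass_mem_transverseKer_two` (`p = 2`, `k + 1 ≤ M(ℓ)`) and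
  `localization_kolyvaginClass_mem_globalTransverse_two` — the binder `hP4` of the S1 composition for the
  GLOBAL intrinsic transverse family.

So P4 at `2` is a THEOREM (no Gross 3.7 (2) input, contrary to the expectation recorded in `S1-PLAN.md`).
HONEST FRAMING: helper (`--supports` 27220); S1 / V2♭θ / BSD are NOT proved here; proofs are byte-for-byte
the odd-`p` ones (cell bsd-jet, seat pv-2) with the one divisibility swapped.
References: [cite: Howard2004HeegnerKolyvagin, Lemma 2.7.3] [cite: Jetchev2008, §3.4.1 (p. 816), Prop. 4.6
(p. 820)] [cite: GrossLMS1991, §3 (3.5), §4 (4.4), (4.6)] [cite: McCallumLMS1991, Lemma 4.3].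
-/

set_option autoImplicit false

noncomputable section

open scoped Classical Pointwise Valued

open WeierstrassCurve Field NumberField IsDedekindDomain Module ValuativeRel
  Literature.NumberTheory.EllipticCurves Literature.NumberTheory.EllipticCurves.RingClassField
  Literature.NumberTheory.EllipticCurves.ModularForms Literature.NumberTheory.EllipticCurves.Jetchev2008
  Literature.NumberTheory.EllipticCurves.KolyvaginCocycle
  Literature.NumberTheory.GaloisRepresentations Literature.NumberTheory.GaloisRepresentations.DiscreteGaloisModule
  Literature.NumberTheory.GaloisRepresentations.IsNonarchimedeanLocalField
  Literature.NumberTheory.NumberFields Literature.NumberTheory.Automorphic Literature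
  Summit.BirchSwinnertonDyer.Rank1Residual.X11b Summit.BirchSwinnertonDyer.Rank1Residual.JET.SelmerVocabulary

namespace Summit.BirchSwinnertonDyer.Rank1Residual.JET

/-! ## §1 Algebra: `red (D_ℓ y)` is `p^k`-divisible as soon as `p^k ∣ ℓ(ℓ+1)/2` -/

section Algebra

variable {G : Type*} [Monoid G] {A : Type*} [AddCommMonoid A] {B : Type*} [AddCommMonoid B]
  (ρ : G →* AddMonoid.End A) (red : A →+ B)

omit [Monoid G] [AddCommMonoid A] [AddCommMonoid B] in
/-- For `2^{k+1} ∣ ℓ + 1` (margin one at `p = 2`): `2^k ∣ ℓ(ℓ+1)/2`. [folklore] -/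
theorem two_pow_dvd_choose_two {k ℓ : ℕ} (h : 2 ^ (k + 1) ∣ ℓ + 1) : 2 ^ k ∣ ℓ * (ℓ + 1) / 2 := by
  obtain ⟨m, hm⟩ := h
  refine ⟨ℓ * m, ?_⟩
  rw [hm, show ℓ * (2 ^ (k + 1) * m) = (2 ^ k * (ℓ * m)) * 2 by ring, Nat.mul_div_cancel _ two_pos]

/-- **`red (D_ℓ y)` is `p^k`-divisible** (in the image of `red`) when `red ∘ σ_ℓ = red` and
`p^k ∣ ℓ(ℓ+1)/2` — twin of `exists_map_derivOp_eq_pow_smul` (there: `p` odd, `p^k ∣ ℓ + 1`).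
[cite: Howard2004HeegnerKolyvagin, Lemma 2.7.3] [cite: Jetchev2008, Prop. 4.6 (p. 820)] -/
theorem exists_map_derivOp_eq_pow_smul_of_dvd {σ : G} (hσ : ∀ a, red (ρ σ a) = red a) {p k ℓ : ℕ}
    (h : p ^ k ∣ ℓ * (ℓ + 1) / 2) (y : A) :
    ∃ b : B, red (KolyvaginOperator.derivOp ρ σ ℓ y) = (p ^ k) • b ∧ ∃ a : A, b = red a := by
  obtain ⟨q, hq⟩ := h
  refine ⟨q • red y, ?_, q • y, (map_nsmul red q y).symm⟩
  rw [map_derivOp_of_map_apply_eq ρ red hσ, hq, mul_nsmul']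

end Algebra

/-! ## §2 BRICK B3 at any prime: the reduction of `P(c)` -/

section Place

variable {K : Type} [Field K] [NumberField K]

/-- **The reduction of `P(c)` is `p^k`-divisible by a `φ²`-fixed point**, ANY prime `p` with
`p^k ∣ ℓ(ℓ+1)/2` (Howard 2004, proof of Lemma 2.7.3; twin of `exists_red_derivedPoint_eq_pow_smul`, whose
`p` odd, `p^k ∣ ℓ + 1` is one way to get the divisibility — at `p = 2` use `2^{k+1} ∣ ℓ + 1`). For `K` imaginary quadratic with `d_K < -4`, `c` square-free with inert prime factors,
a prime `ℓ ∣ c`, `p` odd with `p^k ∣ ℓ + 1`, the place `λ = (ℓ)`, a prime `𝔓 ∣ λ`, concrete Kolyvagin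
data `d` at level `c` and ANY additive `red : E(K̄) → B` into a `Γ_{𝔽̄_ℓ}`-set which is
`I_𝔓`-invariant and carries every `g ≡ (z ↦ z^{ℓ²}) (mod 𝔓)` to `φ₀²`: there is `b ∈ B` with
`red (P(c)) = p^k • b` and `φ₀² • b = b`. [cite: Howard2004HeegnerKolyvagin, Lemma 2.7.3 (proof)]
[cite: GrossLMS1991, §3 (3.5), §4 (4.1)] -/
theorem exists_red_derivedPoint_eq_pow_smul_of_dvd (hK : IsImaginaryQuadratic K) (ι : K →+* ℂ)
    [∀ j : ℕ, NumberField (ringClassField K ι j)] {c ℓ : ℕ} (hc : Squarefree c) (hℓ : ℓ.Prime)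
    (hℓc : ℓ ∣ c) (hinert : ∀ q ∈ c.primeFactors, (Ideal.span {(q : 𝓞 K)}).IsPrime)
    {p k : ℕ} (hchoose : p ^ k ∣ ℓ * (ℓ + 1) / 2)
    {v : HeightOneSpectrum (𝓞 K)} (hv : v.asIdeal = Ideal.span {((ℓ : ℕ) : 𝓞 K)})
    {𝔓 : Ideal (absIntegers (𝓞 K) K)} (h𝔓 : 𝔓 ∈ v.primesAbove)
    {N : ℕ} [NeZero N] {W : WeierstrassCurve ℚ} {Dt : ModularParametrizationData W N} {β : ℤ}
    (d : KolyvaginHeegnerData Dt β ι c)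
    {B : Type*} [AddCommGroup B] {M : Type*} [Monoid M] [DistribMulAction M B] (φ₀ : M)
    (red : geomPoints (W.baseChange K) →+ B)
    (hredI : ∀ τ ∈ 𝔓.inertia (absoluteGaloisGroup K), ∀ x, red (τ • x) = red x)
    (hredF : ∀ g : absoluteGaloisGroup K, (∀ z : absIntegers (𝓞 K) K, g • z - z ^ (ℓ ^ 2) ∈ 𝔓) →
      ∀ x, red (g • x) = (φ₀ ^ 2) • red x) :
    ∃ b : B, red (d.toGeomPoints d.derivedPoint) = (p ^ k) • b ∧ (φ₀ ^ 2) • b = b := by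
  have hc0 : c ≠ 0 := hc.ne_zero
  have hℓpf : ℓ ∈ c.primeFactors := Nat.mem_primeFactors.mpr ⟨hℓ, hℓc, hc0⟩
  have hℓL : ℓ ∈ c.primeFactorsList := Nat.mem_primeFactors_iff_mem_primeFactorsList.mp hℓpf
  have hcℓ0 : c / ℓ ≠ 0 := (Nat.div_pos (Nat.le_of_dvd (Nat.pos_of_ne_zero hc0) hℓc) hℓ.pos).ne'
  have hℓcℓ : ¬ ℓ ∣ c / ℓ := fun h ↦ by
    have : ℓ * ℓ ∣ c := by
      have := Nat.mul_dvd_mul_left ℓ h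
      rwa [Nat.mul_div_cancel' hℓc] at this
    exact hℓ.not_isUnit (hc ℓ this)
  set ρ := pointGalHom W (ringClassField K ι c) with hρ
  -- `d.emb` as a `K`-algebra homomorphism
  let e : ringClassField K ι c →ₐ[K] AlgebraicClosure K := { d.emb with commutes' := d.emb_apply }
  have he : ∀ x, e x = d.emb x := fun _ ↦ rfl
  -- the `σ_q`, `q ∣ c`, and the `s ∈ S` lie in the abelian `𝒢_c`
  have hσG : ∀ q ∈ c.primeFactorsList, d.σ q ∈ ringClassGal ι c := fun q hq ↦ by
    have hq' : q ∈ c.primeFactors := Nat.mem_primeFactors_iff_mem_primeFactorsList.mpr hq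
    have : d.σ q ∈ Subgroup.zpowers (d.σ q) := Subgroup.mem_zpowers _
    rw [d.zpowers_σ q hq'] at this
    exact ringClassGalOver_le_ringClassGal ι c _ this
  have hcomm : ∀ q ∈ c.primeFactorsList, ∀ q' ∈ c.primeFactorsList,
      d.σ q * d.σ q' = d.σ q' * d.σ q := fun q hq q' hq' ↦
    commute_of_mem_ringClassGal hK hc0 (hσG q hq) (hσG q' hq')
  have hS : ∀ s ∈ d.S, ∀ q ∈ c.primeFactorsList, s * d.σ q = d.σ q * s := fun s hs q hq ↦
    commute_of_mem_ringClassGal hK hc0 (d.S_subset s hs) (hσG q hq)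
  -- `P(c) = D_ℓ X'`
  have hP : d.derivedPoint = KolyvaginOperator.derivOp ρ (d.σ ℓ) ℓ
      (∑ s ∈ d.S, ρ s (KolyvaginOperator.derivOpProd ρ d.σ (c.primeFactorsList.erase ℓ) d.y)) :=
    derivedPoint_eq_derivOp ρ d.σ d.S d.y hcomm hS hℓL
  set X' := ∑ s ∈ d.S, ρ s (KolyvaginOperator.derivOpProd ρ d.σ (c.primeFactorsList.erase ℓ) d.y)
    with hX'
  -- `σ_ℓ` is induced by an inertia element: `red ∘ toGeomPoints` is `σ_ℓ`-invariant
  have hv' : ∀ w : HeightOneSpectrum (𝓞 K), ((ℓ : ℕ) : 𝓞 K) ∈ w.asIdeal ↔ w = v := fun w ↦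
    ⟨eq_of_natCast_mem_of_asIdeal_eq_span hv w,
      fun h ↦ by rw [h, hv]; exact Ideal.mem_span_singleton_self _⟩
  have hσA : d.σ ℓ ∈ ringClassGalOver ι c (c / ℓ) := by
    rw [← d.zpowers_σ ℓ hℓpf]; exact Subgroup.mem_zpowers _
  obtain ⟨τ₀, hτ₀I, hτ₀⟩ := RingClassTower.exists_mem_inertia_smul_eq_of_mem_ringClassGalOver hK ι
    hc0 hℓ hℓc hℓcℓ hv' h𝔓 e hσA
  set red' : (W.baseChange (ringClassField K ι c)).toAffine.Point →+ B :=
    red.comp d.toGeomPoints with hred'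
  have hinv : ∀ a, red' (ρ (d.σ ℓ) a) = red' a := fun a ↦ by
    change red (d.toGeomPoints (pointGalHom W (ringClassField K ι c) (d.σ ℓ) a)) =
      red (d.toGeomPoints a)
    rw [← smul_toGeomPoints_eq_toGeomPoints_pointGalHom d (fun x ↦ by rw [← he, ← he]; exact hτ₀ x) a,
      hredI τ₀ hτ₀I]
  -- BRICK p512689: `red' (D_ℓ X') = p^k • (q • red' X')`
  obtain ⟨b, hb, a', ha'⟩ := exists_map_derivOp_eq_pow_smul_of_dvd ρ red' hinv hchoose X'
  -- the ring class Frobenius fixes `X'`, so `φ₀² • red' X' = red' X'`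
  obtain ⟨F, hFz, hFfix⟩ := exists_frobSq_forall_smul_emb_eq hK ι hc hℓ hℓc
    (hinert ℓ hℓpf) hv h𝔓 e
  have hφX : ∀ Y : (W.baseChange (ringClassField K ι c)).toAffine.Point,
      (φ₀ ^ 2) • red' Y = red' Y := fun Y ↦ by
    change (φ₀ ^ 2) • red (d.toGeomPoints Y) = red (d.toGeomPoints Y)
    rw [← hredF F hFz, smul_toGeomPoints_eq_self_of_forall_smul_emb d
      (fun x ↦ by rw [← he]; exact hFfix x) Y]
  refine ⟨b, ?_, ?_⟩
  · rw [hP]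
    exact hb
  · rw [ha', hφX]

end Place

end Summit.BirchSwinnertonDyer.Rank1Residual.JET

end
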